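import Literature.AlgebraicGeometry.HodgeTheory.BettiUniverseTraceIntegralHolomorphic
import Literature.AlgebraicGeometry.HodgeTheory.HolomorphicTopFormClassesBijective
import Literature.AlgebraicGeometry.HodgeTheory.StandardHodgeModel
import Literature.NumberTheory.Transcendental.ComplexFormsPullback
import Literature.NumberTheory.Transcendental.FormIntegrationPullbackProofs
import Literature.NumberTheory.Transcendental.FormIntegrationPositivity
import Mathlib.RingTheory.Norm.Transitivity
import Mathlib.RingTheory.Complex
import HarnessLib

/-!
# `trC (η ∪ conj η') = c · ∫_{X^an} ω_η ∧ ω̄_{η'}` on the STANDARD Hodge model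

Family `hodge`, layer `Literature/AlgebraicGeometry/HodgeTheory`. Theorems only; no definition and
no named fact is introduced.

`BettiUniverseTraceIntegralHolomorphic` proves the Betti-side trace/integral identity
`trC hX (n+n) ((cup X n n ⊗ ℂ) η (conj η')) = c · ∫ ω_η ∧ ω̄_{η'}` (`ω_η := A.topFormOfClass hX h76 η`,
ONE constant continuous orientation, ONE `c ≠ 0`) for every Hodge model `A` whose comparison is a
complexified multiplicative real family `e ⊗ ℂ`, GIVEN a continuous orientation `o` of `X^an_A` and
a closed top form with `∫_o ≠ 0` (`HodgeModel.exists_trC_cup_conj_eq_mul_cintegral_topFormOfClass`),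
and discharges the two geometric inputs on the carrier of a Kähler–rational datum by the Kähler
volume form (Voisin I §3.1.3 Lemma 3.8). This file discharges them on the STANDARD model
`stdModel hHD hX` (`StandardHodgeModel`: the standard analytification `X^an_std` charted on `ℂⁿ`,
comparison `(stdFamily n) ⊗ ℂ`, multiplicative by `stdFamily_isMultiplicative`), which carries no
metric datum, by TRANSPORT along the GAGA biholomorphism `X^an_std ≅ X^an_B` over `X(ℂ)`
(`StdCarrier.toHodgeModel`, holomorphic with holomorphic inverse, Serre GAGA §2 fonctorialité) to
the carrier of a Kähler–rational datum (`nonempty_kaehlerRationalDatum`):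

* `orientationMap_trans` (functoriality of `Orientation.map`), `det_pos_of_map_smul` — a
  real-linear automorphism of a complex vector space commuting with the complex scalars has
  `det_ℝ = |det_ℂ|² > 0` (Huybrechts (2005), Cor. 1.2.3: complex vector spaces are canonically
  oriented) — and `orientationMap_map_symm_eq_of_map_smul` (`L · (L₁⁻¹ · o') = o'` for two such
  equivalences `L₁, L`);
* `exists_orientation_map_mfderiv_eq` — for a diffeomorphism `Φ : M ≃ N` of manifolds charted on
  complex vector spaces which is HOLOMORPHIC, and any orientation `o'` of the model of `N`, there is
  an orientation `o₀` of the model of `M` with `dΦ_x · o₀ = o'` for ALL `x` (the differentials are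
  `ℂ`-linear, `mfderiv_real_eq_restrictScalars`, so `dΦ_x ∘ dΦ_{x₁}⁻¹` has positive determinant);
* `cintegral_pullback_eq` — `∫_M Φ^*β = ∫_N β` for complex top forms and an
  orientation-preserving diffeomorphism `Φ` (Warner (1983), 4.8 (5); Lee (2013), Prop. 16.6 (d):
  the tree's `MForm.integral_pullback_holds` on real and imaginary parts, `MForm.re_pullback` /
  `MForm.im_pullback`);
* `StdCarrier.exists_orientation_cintegral_ne_zero` — on the standard analytification of a smooth
  projective `n`-fold there are a constant continuous orientation `o₀` of `ℂⁿ` (a complex manifold is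
  oriented by every constant orientation family, `isContinuousOrientation_const`) and a closed
  complex top form `F` with `∫_{o₀} F ≠ 0` (`F := Φ^*(ω_gⁿ ⊗ 1)` for the Kähler form of a
  Kähler–rational datum, `KaehlerRationalDatum.exists_orientation_cintegral_ne_zero`);
* `stdModel_exists_trC_cup_conj_eq_mul_cintegral_topFormOfClass` (classes in `Θ⁻¹(H^{n,0})`),
  `…_of_mem_hodge_F` (classes in `FⁿHⁿ` of the universe's Hodge structure, by the
  model-independence `hodgePQ_independent_of_hodgeModel`), `…_surface` (`n = 2`, literal degrees
  `trC hX 4`, `F² H²`, orientations of `ℂ² = ℝ⁴`): the identity ON THE STANDARD MODEL, with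
  `h76 := (stdModel hHD hX).topHolFormClassPQ_bijective hX` (Voisin I Cor. 7.6, the tree's
  `HolomorphicTopFormClassesBijective`) — no hypothesis beyond `hHD`, `hI`.

## References

* C. Voisin, *Hodge Theory and Complex Algebraic Geometry I*, CUP 2002, §3.1.3 Lemma 3.8,
  §6.1.3 Prop. 6.11, §6.3.2, §7.1.1 Def. 7.4 and Cor. 7.6. [VoisinHodgeI2002]
* F. Warner, *Foundations of Differentiable Manifolds and Lie Groups*, GTM 94, Springer 1983,
  4.8 eq. (5), Thm. 5.45. [Warner1983] [WarnerGTM94]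
* D. Huybrechts, *Complex Geometry*, Springer 2005, Cor. 1.2.3. [HuybrechtsCG2005]
* J.-P. Serre, *Géométrie algébrique et géométrie analytique*, Ann. Inst. Fourier 6 (1956), §2.
  [SerreGAGA1956]
-/

noncomputable section

open scoped Manifold ContDiff TensorProduct
open Module
open Literature.Geometry.Kaehler
open Literature.NumberTheory.Transcendental
open Literature.AlgebraicGeometry.Motives (bettiCohomology cintegral)

set_option backward.isDefEq.respectTransparency false

namespace Literature.AlgebraicGeometry.HodgeTheory

/-! ### Orientations: composites of linear equivalences, `ℂ`-linear real automorphisms -/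

section LinearAlgebra

/-- `Orientation.map` is functorial: transporting along `e₁` then `e₂` is transporting along
`e₁ ≫ e₂`. [folklore] -/
theorem orientationMap_trans {R : Type*} [CommRing R] [PartialOrder R] [IsStrictOrderedRing R]
    {M₁ M₂ M₃ : Type*} [AddCommGroup M₁] [Module R M₁] [AddCommGroup M₂] [Module R M₂]
    [AddCommGroup M₃] [Module R M₃] (ι : Type*) (e₁ : M₁ ≃ₗ[R] M₂) (e₂ : M₂ ≃ₗ[R] M₃)
    (x : Orientation R M₁ ι) :
    Orientation.map ι (e₁.trans e₂) x = Orientation.map ι e₂ (Orientation.map ι e₁ x) := by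
  induction x using Module.Ray.ind with
  | h v hv =>
    have key : v.compLinearMap ((e₁.trans e₂).symm : M₃ →ₗ[R] M₁) =
        (v.compLinearMap (e₁.symm : M₂ →ₗ[R] M₁)).compLinearMap (e₂.symm : M₃ →ₗ[R] M₂) := by
      ext u
      rfl
    simp only [Orientation.map_apply, key]

variable {V : Type*} [AddCommGroup V] [Module ℂ V] [FiniteDimensional ℂ V]

/-- **A real-linear automorphism of a finite-dimensional complex vector space commuting with the
complex scalars has positive real determinant**: it is the restriction of scalars of a `ℂ`-linear
automorphism, so `det_ℝ = |det_ℂ|² > 0` (`LinearMap.det_restrictScalars`,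
`Algebra.norm_complex_apply`) — the computation behind "complex vector spaces, hence complex
manifolds, are canonically oriented". [cite: HuybrechtsCG2005, Cor. 1.2.3] -/
theorem det_pos_of_map_smul (T : V ≃ₗ[ℝ] V) (hT : ∀ (c : ℂ) (v : V), T (c • v) = c • T v) :
    0 < LinearMap.det (T : V →ₗ[ℝ] V) := by
  let Tc : V →ₗ[ℂ] V :=
    { toFun := T
      map_add' := fun v w ↦ map_add T v w
      map_smul' := hT }
  have h : (T : V →ₗ[ℝ] V) = Tc.restrictScalars ℝ := LinearMap.ext fun _ ↦ rfl
  have hne : LinearMap.det (T : V →ₗ[ℝ] V) ≠ 0 := T.isUnit_det'.ne_zero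
  rw [h, LinearMap.det_restrictScalars, Algebra.norm_complex_apply] at hne ⊢
  exact lt_of_le_of_ne (Complex.normSq_nonneg _) (Ne.symm hne)

/-- Linear algebra of the transport: if `L₁, L : W ≃ V` are real-linear equivalences of complex
vector spaces commuting with the complex scalars, then `L · (L₁⁻¹ · o') = o'` for every orientation
`o'` of `V` (`L ∘ L₁⁻¹` commutes with `ℂ`, so has positive determinant, `det_pos_of_map_smul`,
`Orientation.map_eq_iff_det_pos`). [cite: HuybrechtsCG2005, Cor. 1.2.3] -/
theorem orientationMap_map_symm_eq_of_map_smul {W : Type*} [AddCommGroup W] [Module ℂ W] {m : ℕ}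
    [Fact (finrank ℝ V = m)] (L₁ L : W ≃ₗ[ℝ] V) (h₁ : ∀ (c : ℂ) (v : W), L₁ (c • v) = c • L₁ v)
    (h : ∀ (c : ℂ) (v : W), L (c • v) = c • L v) (o' : Orientation ℝ V (Fin m)) :
    Orientation.map (Fin m) L (Orientation.map (Fin m) L₁.symm o') = o' := by
  rw [← orientationMap_trans]
  refine (Orientation.map_eq_iff_det_pos o' _
    ((Fintype.card_fin m).trans (Fact.out : finrank ℝ V = m).symm)).2
      (det_pos_of_map_smul _ fun c w ↦ ?_)
  have hs : L₁.symm (c • w) = c • L₁.symm w := by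
    apply L₁.injective
    rw [h₁, L₁.apply_symm_apply, L₁.apply_symm_apply]
  change L (L₁.symm (c • w)) = c • L (L₁.symm w)
  rw [hs, h]

end LinearAlgebra

/-! ### Holomorphic diffeomorphisms transport constant orientations and integrals -/

section Biholomorphic

variable {E E' : Type*} [NormedAddCommGroup E] [NormedSpace ℂ E]
  [NormedAddCommGroup E'] [NormedSpace ℂ E']
  {M : Type*} [TopologicalSpace M] [ChartedSpace E M]
  {N : Type*} [TopologicalSpace N] [ChartedSpace E' N]

/-- **A holomorphic diffeomorphism is orientation-preserving for suitable constant orientations**: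
for `Φ : M ≃ N` a diffeomorphism of (non-empty) manifolds charted on complex vector spaces which is
holomorphic, and any orientation `o'` of the model of `N`, there is an orientation `o₀` of the model
of `M` with `dΦ_x · o₀ = o'` for every `x ∈ M`: `o₀ := dΦ_{x₁}⁻¹ · o'`, and
`dΦ_x · o₀ = (dΦ_x ∘ dΦ_{x₁}⁻¹) · o' = o'` as the differentials commute with the complex scalars
(`mfderiv_real_apply_smul`: the real differential of a holomorphic map is `ℂ`-linear), so that
automorphism has positive determinant. [cite: HuybrechtsCG2005, Cor. 1.2.3] -/
theorem exists_orientation_map_mfderiv_eq [FiniteDimensional ℂ E'] [Nonempty M] {m : ℕ}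
    [Fact (finrank ℝ E' = m)]
    (Φ : Diffeomorph 𝓘(ℝ, E) 𝓘(ℝ, E') M N ∞) (hΦ : MDifferentiable 𝓘(ℂ, E) 𝓘(ℂ, E') Φ)
    (o' : Orientation ℝ E' (Fin m)) :
    ∃ o₀ : Orientation ℝ E (Fin m), ∀ x : M,
      Orientation.map (Fin m) (Φ.mfderivToContinuousLinearEquiv (by simp) x).toLinearEquiv o₀ = o' := by
  obtain ⟨x₁⟩ := ‹Nonempty M›
  exact ⟨Orientation.map (Fin m) (Φ.mfderivToContinuousLinearEquiv (by simp) x₁).toLinearEquiv.symm o',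
    fun x ↦ orientationMap_map_symm_eq_of_map_smul (W := E) (V := E')
      (Φ.mfderivToContinuousLinearEquiv (by simp) x₁).toLinearEquiv
      (Φ.mfderivToContinuousLinearEquiv (by simp) x).toLinearEquiv
      (fun c v ↦ mfderiv_real_apply_smul (hΦ x₁) c v) (fun c v ↦ mfderiv_real_apply_smul (hΦ x) c v)
      o'⟩

variable [FiniteDimensional ℂ E] [FiniteDimensional ℂ E']
  [IsManifold 𝓘(ℝ, E) ∞ M] [IsManifold 𝓘(ℝ, E') ∞ N]
  {m : ℕ} [Fact (finrank ℝ E = m)] [Fact (finrank ℝ E' = m)]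
  [MeasurableSpace E] [BorelSpace E] [MeasurableSpace E'] [BorelSpace E']
  [T2Space M] [SigmaCompactSpace M] [T2Space N] [SigmaCompactSpace N] [CompactSpace N]

/-- **Diffeomorphism invariance of the integral of complex top forms**, `∫_M Φ^*β = ∫_N β` for an
orientation-preserving diffeomorphism `Φ` onto a compact manifold with a continuous orientation
family and a smooth complex top form `β` (the tree's `MForm.integral_pullback_holds` on real and
imaginary parts). [cite: Warner1983, 4.8(5)] -/
theorem cintegral_pullback_eq (o : (x : M) → Orientation ℝ (TangentSpace 𝓘(ℝ, E) x) (Fin m))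
    (o' : (y : N) → Orientation ℝ (TangentSpace 𝓘(ℝ, E') y) (Fin m))
    (ho' : IsContinuousOrientation o') (Φ : Diffeomorph 𝓘(ℝ, E) 𝓘(ℝ, E') M N ∞)
    (hΦ : ∀ x, Orientation.map (Fin m) (Φ.mfderivToContinuousLinearEquiv (by simp) x).toLinearEquiv
      (o x) = o' (Φ x))
    {β : MForm 𝓘(ℝ, E') N ℂ m} (hβ : IsSmoothForm β) :
    cintegral o (β.pullback 𝓘(ℝ, E) Φ) = cintegral o' β := by
  have hre : MForm.integral o (β.re.pullback 𝓘(ℝ, E) Φ) = MForm.integral o' β.re :=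
    MForm.integral_pullback_holds o o' ho' Φ hΦ hβ.re
  have him : MForm.integral o (β.im.pullback 𝓘(ℝ, E) Φ) = MForm.integral o' β.im :=
    MForm.integral_pullback_holds o o' ho' Φ hΦ hβ.im
  rw [cintegral, cintegral, MForm.re_pullback, MForm.im_pullback, hre, him]

end Biholomorphic

/-! ### The standard analytification: orientation and a top form with non-zero integral -/

section Standard

variable {n : ℕ} {X : Motives.SchemeOver ℂ}

/-- **On the standard analytification `X^an_std` (charted on `ℂⁿ`) of a smooth projective `n`-fold
there are a constant continuous orientation `o₀` of `ℂⁿ` and a closed complex top form with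
`∫_{o₀} ≠ 0`.** Proof: take a Kähler–rational datum `D` of `X` (`nonempty_kaehlerRationalDatum`),
its constant complex orientation `o'` and the closed top form `ω_gⁿ ⊗ 1` with `∫ ≠ 0`
(`KaehlerRationalDatum.exists_orientation_cintegral_ne_zero`, Voisin I §3.1.3 Lemma 3.8); the
comparison `Φ : X^an_std ≅ D.B.carrier` over `X(ℂ)` is a holomorphic diffeomorphism (GAGA §2,
`StdCarrier.mdifferentiable_toHodgeModel` / `_ofHodgeModel`), so `o₀ := dΦ⁻¹ · o'` is `Φ`-related to
`o'` everywhere (`exists_orientation_map_mfderiv_eq`), continuous as is every constant orientation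
family of a complex manifold (`isContinuousOrientation_const`), and `∫_{o₀} Φ^*(ω_gⁿ ⊗ 1) =
∫_{o'} ω_gⁿ ⊗ 1 ≠ 0` (`cintegral_pullback_eq`, Warner 4.8 (5)); `Φ^*` preserves closed smooth forms
(`pullback_mem_cclosedSmoothForms`). [cite: VoisinHodgeI2002, §3.1.3 Lemma 3.8]
[cite: HuybrechtsCG2005, Cor. 1.2.3] [cite: Warner1983, 4.8(5)] -/
theorem StdCarrier.exists_orientation_cintegral_ne_zero (S : StdCarrier n X)
    (hX : Motives.IsSmoothProjective n X) {m : ℕ} (hm : m = 2 * n)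
    [MeasurableSpace (Fin n → ℂ)] [BorelSpace (Fin n → ℂ)] [Fact (finrank ℝ (Fin n → ℂ) = m)] :
    ∃ o₀ : Orientation ℝ (Fin n → ℂ) (Fin m),
      IsContinuousOrientation (I := 𝓘(ℝ, Fin n → ℂ)) (M := S.carrier) (fun _ ↦ o₀) ∧
        ∃ F : cclosedSmoothForms (Fin n → ℂ) S.carrier m,
          cintegral (fun _ : S.carrier ↦ o₀) (F : MForm 𝓘(ℝ, Fin n → ℂ) S.carrier ℂ m) ≠ 0 := by
  obtain ⟨D⟩ := nonempty_kaehlerRationalDatum hX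
  letI : MeasurableSpace D.B.model := borel _
  haveI : BorelSpace D.B.model := ⟨rfl⟩
  haveI : Fact (finrank ℝ D.B.model = m) :=
    ⟨by rw [finrank_real_of_complex, D.B.isAnalytification.finrank_eq, hm]⟩
  haveI : CompactSpace D.B.carrier := by
    haveI := Motives.ComplexPoints.compactSpace_of_isSmoothProjective hX
    exact D.B.isAnalytification.homeomorph.symm.compactSpace
  haveI : CompleteSpace D.B.model := FiniteDimensional.complete ℂ D.B.model
  haveI : CompleteSpace (Fin n → ℂ) := FiniteDimensional.complete ℂ (Fin n → ℂ)
  -- the Kähler side: orientation and the top form `ω_gⁿ ⊗ 1`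
  obtain ⟨o', ho', F₀, hF₀⟩ := D.exists_orientation_cintegral_ne_zero hX hm
  -- the GAGA biholomorphism `X^an_std ≅ D.B.carrier` as a diffeomorphism
  have hf := S.mdifferentiable_toHodgeModel hX D.B
  have hg := S.mdifferentiable_ofHodgeModel hX D.B
  let Φ : Diffeomorph 𝓘(ℝ, Fin n → ℂ) 𝓘(ℝ, D.B.model) S.carrier D.B.carrier ∞ :=
    { toFun := S.toHodgeModel D.B
      invFun := S.ofHodgeModel D.B
      left_inv := S.ofHodgeModel_toHodgeModel D.B
      right_inv := S.toHodgeModel_ofHodgeModel D.B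
      contMDiff_toFun := hf.contMDiff_real_of_complex
      contMDiff_invFun := hg.contMDiff_real_of_complex }
  have hΦ : MDifferentiable 𝓘(ℂ, Fin n → ℂ) 𝓘(ℂ, D.B.model) Φ := hf
  -- `X^an_std` is non-empty (it is homeomorphic to the connected `D.B.carrier`)
  haveI : ConnectedSpace D.B.carrier := D.B.connectedSpace_carrier hX
  haveI : Nonempty S.carrier := ⟨S.ofHodgeModel D.B (Classical.arbitrary D.B.carrier)⟩
  obtain ⟨o₀, ho₀⟩ := exists_orientation_map_mfderiv_eq Φ hΦ o'
  obtain ⟨hF₀s, -⟩ := (mem_cclosedSmoothForms_iff (F₀ : MForm 𝓘(ℝ, D.B.model) D.B.carrier ℂ m)).1 F₀.2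
  refine ⟨o₀, isContinuousOrientation_const o₀,
    ⟨(F₀ : MForm 𝓘(ℝ, D.B.model) D.B.carrier ℂ m).pullback 𝓘(ℝ, Fin n → ℂ) Φ,
      pullback_mem_cclosedSmoothForms Φ.contMDiff F₀.2⟩, ?_⟩
  change cintegral (fun _ : S.carrier ↦ o₀)
    ((F₀ : MForm 𝓘(ℝ, D.B.model) D.B.carrier ℂ m).pullback 𝓘(ℝ, Fin n → ℂ) Φ) ≠ 0
  rwa [cintegral_pullback_eq (fun _ : S.carrier ↦ o₀) (fun _ : D.B.carrier ↦ o') ho' Φ ho₀ hF₀s]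

/-! ### The trace/integral identity on the standard Hodge model -/

/-- **`trC (η ∪ conj η') = c · ∫_{X^an_std} ω_η ∧ ω̄_{η'}` on `Θ⁻¹(H^{n,0})` for the STANDARD Hodge
model** `A := stdModel hHD hX` (comparison `(stdFamily n) ⊗ ℂ`, multiplicative): one constant
continuous orientation `o₀` of `ℂⁿ` and ONE `c ≠ 0` with
`trC hX (n+n) ((cup X n n ⊗ ℂ) η (conj η')) = c · ∫_{o₀} (A.topFormOfClass η) ∧ conj (A.topFormOfClass η')`
for all `η, η' ∈ Θ_A⁻¹(H^{n,0})` (`HodgeModel.exists_trC_cup_conj_eq_mul_cintegral_topFormOfClass`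
with `hem := stdFamily_isMultiplicative`, `hde := rfl` and the orientation / top form of
`StdCarrier.exists_orientation_cintegral_ne_zero`; `h76` — Voisin I Cor. 7.6 — is a parameter,
dischargeable by `(stdModel hHD hX).topHolFormClassPQ_bijective hX`).
[cite: VoisinHodgeI2002, §6.3.2, Cor. 6.12 and Cor. 7.6] [cite: WarnerGTM94, Thm. 5.45] -/
theorem stdModel_exists_trC_cup_conj_eq_mul_cintegral_topFormOfClass
    (hHD : exists_isReal_hodgeModel) (hX : Motives.IsSmoothProjective n X)
    (h76 : Function.Bijective (stdModel hHD hX).topHolFormClassPQ)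
    [MeasurableSpace (Fin n → ℂ)] [BorelSpace (Fin n → ℂ)] [Fact (finrank ℝ (Fin n → ℂ) = n + n)] :
    ∃ (o₀ : Orientation ℝ (Fin n → ℂ) (Fin (n + n))) (c : ℂ),
      IsContinuousOrientation (I := 𝓘(ℝ, Fin n → ℂ)) (M := (stdCarrier hX).carrier) (fun _ ↦ o₀) ∧
        c ≠ 0 ∧
      ∀ η η' : ℂ ⊗[ℚ] bettiCohomology X n, η ∈ (stdModel hHD hX).ratPiece hX n n 0 →
        η' ∈ (stdModel hHD hX).ratPiece hX n n 0 →
        BettiUniverse.trC hX (n + n) (LinearMap.BilinMap.baseChange ℂ (BettiUniverse.cup X n n) η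
            (Motives.HodgeStructure.conj η')) =
          c * cintegral (fun _ : (stdCarrier hX).carrier ↦ o₀)
            (((stdModel hHD hX).topFormOfClass hX h76 η :
                MForm 𝓘(ℝ, Fin n → ℂ) (stdCarrier hX).carrier ℂ n).wedge
              ((stdModel hHD hX).topFormOfClass hX h76 η' :
                MForm 𝓘(ℝ, Fin n → ℂ) (stdCarrier hX).carrier ℂ n).conj) := by
  obtain ⟨o₀, ho, hI⟩ :=
    (stdCarrier hX).exists_orientation_cintegral_ne_zero hX (two_mul n).symm
  obtain ⟨c, hc0, h⟩ :=
    (stdModel hHD hX).exists_trC_cup_conj_eq_mul_cintegral_topFormOfClass hX (stdFamily n)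
      (stdFamily_isMultiplicative n) (fun _ ↦ rfl) (fun _ ↦ o₀) ho hI h76
  exact ⟨o₀, c, ho, hc0, h⟩

/-- **The geometric side of `InnerEmbAt`/C2 on the standard model, whole**: for `η, η' ∈ FⁿHⁿ` of
the universe's Hodge structure `BettiUniverse.hodge hHD hX n` (`= Θ_std⁻¹(H^{n,0})` by
model-independence, Voisin I Prop. 6.11), `trC hX (n+n) ((cup X n n ⊗ ℂ) η (conj η')) =
c · ∫_{X^an_std} ω_η ∧ ω̄_{η'}` with `ω_η := (stdModel hHD hX).topFormOfClass hX h76 η`, one constant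
continuous orientation of `ℂⁿ` and ONE `c ≠ 0`.
[cite: VoisinHodgeI2002, §6.3.2, Cor. 7.6, §6.1.3 Prop. 6.11 and §7.1.1 Def. 7.4]
[cite: WarnerGTM94, Thm. 5.45] -/
theorem stdModel_exists_trC_cup_conj_eq_mul_cintegral_topFormOfClass_of_mem_hodge_F
    (hHD : exists_isReal_hodgeModel) (hI : hodgePQ_independent_of_hodgeModel)
    (hX : Motives.IsSmoothProjective n X)
    (h76 : Function.Bijective (stdModel hHD hX).topHolFormClassPQ)
    [MeasurableSpace (Fin n → ℂ)] [BorelSpace (Fin n → ℂ)] [Fact (finrank ℝ (Fin n → ℂ) = n + n)] :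
    ∃ (o₀ : Orientation ℝ (Fin n → ℂ) (Fin (n + n))) (c : ℂ),
      IsContinuousOrientation (I := 𝓘(ℝ, Fin n → ℂ)) (M := (stdCarrier hX).carrier) (fun _ ↦ o₀) ∧
        c ≠ 0 ∧
      ∀ η η' : ℂ ⊗[ℚ] bettiCohomology X n, η ∈ (BettiUniverse.hodge hHD hX n).F n →
        η' ∈ (BettiUniverse.hodge hHD hX n).F n →
        BettiUniverse.trC hX (n + n) (LinearMap.BilinMap.baseChange ℂ (BettiUniverse.cup X n n) η
            (Motives.HodgeStructure.conj η')) =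
          c * cintegral (fun _ : (stdCarrier hX).carrier ↦ o₀)
            (((stdModel hHD hX).topFormOfClass hX h76 η :
                MForm 𝓘(ℝ, Fin n → ℂ) (stdCarrier hX).carrier ℂ n).wedge
              ((stdModel hHD hX).topFormOfClass hX h76 η' :
                MForm 𝓘(ℝ, Fin n → ℂ) (stdCarrier hX).carrier ℂ n).conj) := by
  obtain ⟨o₀, c, ho, hc0, h⟩ :=
    stdModel_exists_trC_cup_conj_eq_mul_cintegral_topFormOfClass hHD hX h76
  refine ⟨o₀, c, ho, hc0, fun η η' hη hη' ↦ h η η' ?_ ?_⟩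
  · exact (BettiUniverse.mem_hodge_F_self_iff_mem_ratPiece hHD hI hX (stdModel hHD hX) n η).1
      (by exact_mod_cast hη)
  · exact (BettiUniverse.mem_hodge_F_self_iff_mem_ratPiece hHD hI hX (stdModel hHD hX) n η').1
      (by exact_mod_cast hη')

/-- **Surface case on the standard model, literal degrees, `h76` discharged** (the shape of
`InnerEmbAt`/C2 for the Picard modular surface read in `stdModel`: `trC hX 4 ((cup X 2 2 ⊗ ℂ) η
(conj η'))`, `η, η' ∈ F²H²`, `ω_η := (stdModel hHD hX).topFormOfClass hX
((stdModel hHD hX).topHolFormClassPQ_bijective hX) η`, orientations of `ℂ² = ℝ⁴`).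
[cite: VoisinHodgeI2002, §6.3.2, Cor. 7.6 and §7.1.1 Def. 7.4] [cite: WarnerGTM94, Thm. 5.45] -/
theorem stdModel_exists_trC_cup_conj_eq_mul_cintegral_topFormOfClass_surface
    {X : Motives.SchemeOver ℂ} (hHD : exists_isReal_hodgeModel)
    (hI : hodgePQ_independent_of_hodgeModel) (hX : Motives.IsSmoothProjective 2 X)
    [MeasurableSpace (Fin 2 → ℂ)] [BorelSpace (Fin 2 → ℂ)] [Fact (finrank ℝ (Fin 2 → ℂ) = 4)] :
    ∃ (o₀ : Orientation ℝ (Fin 2 → ℂ) (Fin 4)) (c : ℂ),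
      IsContinuousOrientation (I := 𝓘(ℝ, Fin 2 → ℂ)) (M := (stdCarrier hX).carrier) (fun _ ↦ o₀) ∧
        c ≠ 0 ∧
      ∀ η η' : ℂ ⊗[ℚ] bettiCohomology X 2, η ∈ (BettiUniverse.hodge hHD hX 2).F 2 →
        η' ∈ (BettiUniverse.hodge hHD hX 2).F 2 →
        BettiUniverse.trC hX 4 (LinearMap.BilinMap.baseChange ℂ (BettiUniverse.cup X 2 2) η
            (Motives.HodgeStructure.conj η')) =
          c * cintegral (fun _ : (stdCarrier hX).carrier ↦ o₀)
            (((stdModel hHD hX).topFormOfClass hX ((stdModel hHD hX).topHolFormClassPQ_bijective hX) η :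
                MForm 𝓘(ℝ, Fin 2 → ℂ) (stdCarrier hX).carrier ℂ 2).wedge
              ((stdModel hHD hX).topFormOfClass hX ((stdModel hHD hX).topHolFormClassPQ_bijective hX) η' :
                MForm 𝓘(ℝ, Fin 2 → ℂ) (stdCarrier hX).carrier ℂ 2).conj) := by
  obtain ⟨o₀, c, ho, hc0, h⟩ :=
    stdModel_exists_trC_cup_conj_eq_mul_cintegral_topFormOfClass_of_mem_hodge_F hHD hI hX
      ((stdModel hHD hX).topHolFormClassPQ_bijective hX)
  exact ⟨o₀, c, ho, hc0, h⟩

end Standard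

end Literature.AlgebraicGeometry.HodgeTheory

end
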